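import Summits.QuantumAdvantage.QuantumAdvantage.Theorems.LinnikCubicClassGroupsDegreeOnePrimesEscapeDivisionPNTPiLemmas
import Summits.QuantumAdvantage.QuantumAdvantage.Theorems.LinnikCubicClassGroupsDegreeOnePrimesEscapeDivisionPNTWindow
import HarnessLib

/-!
# The `π`-form of the division prime number theorem with an arbitrarily small exceptional window

Topic `Summits/QuantumAdvantage/QuantumAdvantage/Theorems`, cell B2b-1 (linnik-cubic), PART A (gen 11);
helper toward the crux `DegreeOnePrimesEscape` (stmt-QuantumAdvantage-11543) of route
`LinnikCubicClassGroups`.  HONEST FRAMING: the value of this file is a THEOREM (kernel-checked, GRH-free,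
Siegel-free, no hypothesis) — NOT summit progress.

`division_PNT_pi` (`…DivisionPNTPi.lean`, gen 10) is the printed `π`-form of the Chebotarev prime number
theorem for Frobenius divisions in the Linnik range, with SOME window constant `c = c(n, ε) ≤ 1/4` for the
exceptional case "`ζ_N` has a real zero `β₁ ∈ (1 − c/(log d + log 4), 1)`".  Here (`division_PNT_pi_window`)
the window constant is made `≤ c'` for any prescribed `c' > 0`, exactly as `division_PNT_window`
(`…DivisionPNTWindow.lean`) does for the `θ`-form: the proof is the `θ → π` transfer of `division_PNT_pi`
(Abel summation `card_filter_primesLE_eq_div_log_add_integral`, `division_pi_transfer`, Stark's bound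
`exceptional_mainTerm_ge` for the main term at the exceptional zero) run on `division_PNT_window`.
This is the form in which the exceptional case can be EXCLUDED from a zero-free interval `[1 − c₀, 1)` of
the quadratic subfields (pure cubic fields: `…SplittingTypePNTPureCubic.lean`).
[cite: LagariasMontgomeryOdlyzko1979, Theorem 1.1] [cite: ThornerZaman2019, Theorem 1.4]
-/

noncomputable section

open scoped NumberField nonZeroDivisors
open Finset Real Ideal NumberField MeasureTheory Set
open Literature.NumberTheory.NumberFields Literature.NumberTheory.LFunctions
  Literature.NumberTheory.LFunctions.NumberField Literature.NumberTheory.LFunctions.AbelianDensity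

namespace Summit.QuantumAdvantage.QuantumAdvantage.Theorems.DegreeOnePrimesEscape

set_option maxHeartbeats 4000000 in
open scoped Classical in
/-- **The `π`-form of the division prime number theorem with a prescribed window**: for `n > 1`,
`0 < ε ≤ 1` and `c' > 0` there are `L > 0` and `0 < c ≤ min c' (1/4)` such that for every Galois number
field `N` of degree `n`, every `σ ∈ Gal(N/ℚ)` and every `x ≥ d^L` (`d = |d_N|`, `δ = |Div σ|/|G|`,
`π(x) = #{p ≤ x : p ∤ d_N, Frob_p ∈ Div σ}`, `Li = offsetLogIntegral`): (A) if `ζ_N` has no real zero in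
`(1 − c/(log d + log 4), 1)` then `|π(x) − δ Li(x)| ≤ ε δ Li(x)`; (B) if `β₁` is such a zero then
`|π(x) − δ(Li(x) ∓ Li(x^{β₁}))| ≤ ε δ (Li(x) ∓ Li(x^{β₁}))`, sign `−` iff `ζ_{N^{⟨σ⟩}}(β₁) = 0`.  Unconditional.
[cite: LagariasMontgomeryOdlyzko1979, Theorem 1.1] [cite: ThornerZaman2019, Theorem 1.4] -/
theorem division_PNT_pi_window (n : ℕ) (hn : 1 < n) {ε : ℝ} (hε : 0 < ε) (hε1 : ε ≤ 1) {c' : ℝ}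
    (hc' : 0 < c') :
    ∃ L c : ℝ, 0 < L ∧ 0 < c ∧ c ≤ c' ∧ c ≤ 1 / 4 ∧ ∀ (N : Type) [Field N] [NumberField N] [IsGalois ℚ N],
      Module.finrank ℚ N = n → ∀ σ : N ≃ₐ[ℚ] N,
        ((¬ ∃ β₁ : ℝ, dedekindZeta₁ N β₁ = 0 ∧
            1 - c / (Real.log ((NumberField.discr N).natAbs : ℝ) + Real.log 4) < β₁ ∧ β₁ < 1) →
          ∀ x : ℝ, ((NumberField.discr N).natAbs : ℝ) ^ L ≤ x →
            |((((Nat.primesLE ⌊x⌋₊).filter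
                (fun p : ℕ => ¬ ((p : ℤ) ∣ NumberField.discr N) ∧
                  ∃ (Q : Ideal (𝓞 N)) (_ : Q.IsMaximal) (_ : Q.LiesOver (span {(p : ℤ)})) (φ g : N ≃ₐ[ℚ] N),
                    IsArithFrobAt ℤ φ Q ∧ Q.inertia (N ≃ₐ[ℚ] N) = ⊥ ∧
                      Subgroup.zpowers (g * φ * g⁻¹) = Subgroup.zpowers σ)).card : ℕ) : ℝ) -
              (Nat.card {τ : N ≃ₐ[ℚ] N // ∃ g : N ≃ₐ[ℚ] N,
                  Subgroup.zpowers (g * τ * g⁻¹) = Subgroup.zpowers σ} : ℝ) / Nat.card (N ≃ₐ[ℚ] N) *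
                offsetLogIntegral x| ≤
              ε * ((Nat.card {τ : N ≃ₐ[ℚ] N // ∃ g : N ≃ₐ[ℚ] N,
                  Subgroup.zpowers (g * τ * g⁻¹) = Subgroup.zpowers σ} : ℝ) / Nat.card (N ≃ₐ[ℚ] N) *
                offsetLogIntegral x)) ∧
        (∀ β₁ : ℝ, dedekindZeta₁ N β₁ = 0 →
          1 - c / (Real.log ((NumberField.discr N).natAbs : ℝ) + Real.log 4) < β₁ → β₁ < 1 →
          (dedekindZeta₁ (IntermediateField.fixedField (Subgroup.zpowers σ)) β₁ = 0 →
            ∀ x : ℝ, ((NumberField.discr N).natAbs : ℝ) ^ L ≤ x →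
              |((((Nat.primesLE ⌊x⌋₊).filter
                  (fun p : ℕ => ¬ ((p : ℤ) ∣ NumberField.discr N) ∧
                    ∃ (Q : Ideal (𝓞 N)) (_ : Q.IsMaximal) (_ : Q.LiesOver (span {(p : ℤ)})) (φ g : N ≃ₐ[ℚ] N),
                      IsArithFrobAt ℤ φ Q ∧ Q.inertia (N ≃ₐ[ℚ] N) = ⊥ ∧
                        Subgroup.zpowers (g * φ * g⁻¹) = Subgroup.zpowers σ)).card : ℕ) : ℝ) -
                (Nat.card {τ : N ≃ₐ[ℚ] N // ∃ g : N ≃ₐ[ℚ] N,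
                    Subgroup.zpowers (g * τ * g⁻¹) = Subgroup.zpowers σ} : ℝ) / Nat.card (N ≃ₐ[ℚ] N) *
                  (offsetLogIntegral x - offsetLogIntegral (x ^ β₁))| ≤
                ε * ((Nat.card {τ : N ≃ₐ[ℚ] N // ∃ g : N ≃ₐ[ℚ] N,
                    Subgroup.zpowers (g * τ * g⁻¹) = Subgroup.zpowers σ} : ℝ) / Nat.card (N ≃ₐ[ℚ] N) *
                  (offsetLogIntegral x - offsetLogIntegral (x ^ β₁)))) ∧
          (dedekindZeta₁ (IntermediateField.fixedField (Subgroup.zpowers σ)) β₁ ≠ 0 →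
            ∀ x : ℝ, ((NumberField.discr N).natAbs : ℝ) ^ L ≤ x →
              |((((Nat.primesLE ⌊x⌋₊).filter
                  (fun p : ℕ => ¬ ((p : ℤ) ∣ NumberField.discr N) ∧
                    ∃ (Q : Ideal (𝓞 N)) (_ : Q.IsMaximal) (_ : Q.LiesOver (span {(p : ℤ)})) (φ g : N ≃ₐ[ℚ] N),
                      IsArithFrobAt ℤ φ Q ∧ Q.inertia (N ≃ₐ[ℚ] N) = ⊥ ∧
                        Subgroup.zpowers (g * φ * g⁻¹) = Subgroup.zpowers σ)).card : ℕ) : ℝ) -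
                (Nat.card {τ : N ≃ₐ[ℚ] N // ∃ g : N ≃ₐ[ℚ] N,
                    Subgroup.zpowers (g * τ * g⁻¹) = Subgroup.zpowers σ} : ℝ) / Nat.card (N ≃ₐ[ℚ] N) *
                  (offsetLogIntegral x + offsetLogIntegral (x ^ β₁))| ≤
                ε * ((Nat.card {τ : N ≃ₐ[ℚ] N // ∃ g : N ≃ₐ[ℚ] N,
                    Subgroup.zpowers (g * τ * g⁻¹) = Subgroup.zpowers σ} : ℝ) / Nat.card (N ≃ₐ[ℚ] N) *
                  (offsetLogIntegral x + offsetLogIntegral (x ^ β₁))))) := by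
  have hn0 : (0 : ℝ) < n := by exact_mod_cast (lt_trans Nat.zero_lt_one hn)
  have hn1 : (1 : ℝ) ≤ n := by exact_mod_cast hn.le
  set ε₀ : ℝ := ε / 60 with hε₀
  have hε₀0 : 0 < ε₀ := by positivity
  have hε₀1 : ε₀ ≤ 1 := by rw [hε₀]; linarith
  obtain ⟨L₀, c, hL₀, hc, hcc', hc4, h⟩ := division_PNT_window n hn hε₀0 hε₀1 hc'
  obtain ⟨c₁, hc₁, hc₁1, hMT⟩ := exceptional_mainTerm_ge n hn
  set e : ℝ := (1 : ℝ) + n * n with he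
  set L₁ : ℝ := max L₀ 1 with hL₁
  set K : ℝ := 4608 * n / (ε * c₁) with hK
  have hK1 : 1 ≤ K := by
    rw [hK, le_div_iff₀ (by positivity)]; nlinarith [mul_le_mul hε1 hc₁1 hc₁.le zero_le_one]
  obtain ⟨L, hL, hthr⟩ := pi_thresholds (2 * L₁) e hK1
  refine ⟨L, c, hL, hc, hcc', hc4, fun N _ _ _ hN σ => ?_⟩
  obtain ⟨hA, hB⟩ := h N hN σ
  -- sizes depending on `N`, `σ`
  have hN1 : 1 < Module.finrank ℚ N := by rw [hN]; exact hn
  set d : ℝ := ((NumberField.discr N).natAbs : ℝ) with hd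
  have hd3 : (3 : ℝ) ≤ d := three_le_natAbs_discr_real N hN1
  obtain ⟨hd0, hd1⟩ : (0 : ℝ) < d ∧ (1 : ℝ) ≤ d := ⟨by linarith, by linarith⟩
  obtain ⟨hδ0, hδ1⟩ := divisionDensity_pos_le_one σ
  set δ : ℝ := (Nat.card {τ : N ≃ₐ[ℚ] N // ∃ g : N ≃ₐ[ℚ] N,
      Subgroup.zpowers (g * τ * g⁻¹) = Subgroup.zpowers σ} : ℝ) / Nat.card (N ≃ₐ[ℚ] N) with hδ
  have hδn : 1 / (n : ℝ) ≤ δ := by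
    rw [hδ, ← hN, ← IsGalois.card_aut_eq_finrank]
    apply div_le_div_of_nonneg_right _ (by positivity)
    exact_mod_cast one_le_card_division σ
  set Pgood : ℕ → Prop := fun p : ℕ => ¬ ((p : ℤ) ∣ NumberField.discr N) ∧
      ∃ (Q : Ideal (𝓞 N)) (_ : Q.IsMaximal) (_ : Q.LiesOver (span {(p : ℤ)})) (φ g : N ≃ₐ[ℚ] N),
        IsArithFrobAt ℤ φ Q ∧ Q.inertia (N ≃ₐ[ℚ] N) = ⊥ ∧
          Subgroup.zpowers (g * φ * g⁻¹) = Subgroup.zpowers σ with hPgood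
  set T : ℝ → ℝ := fun t => ∑ p ∈ (Nat.primesLE ⌊t⌋₊).filter Pgood, Real.log p with hT
  -- the common data at `x ≥ d^L`
  set y : ℝ := d ^ L₁ with hy
  have hy2 : 2 ≤ y := le_trans (by linarith : (2 : ℝ) ≤ d) (by
    have := Real.rpow_le_rpow_of_exponent_le hd1 (le_max_right L₀ 1); rwa [Real.rpow_one] at this)
  have hyL₀ : d ^ L₀ ≤ y := Real.rpow_le_rpow_of_exponent_le hd1 (le_max_left _ _)
  have hT0 : ∀ t, 2 ≤ t → 0 ≤ T t := fun t ht => (sum_filter_primesLE_log_le Pgood (by linarith)).1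
  have hTB : ∀ t, 2 ≤ t → T t ≤ Real.log 4 * t := fun t ht => (sum_filter_primesLE_log_le Pgood (by linarith)).2
  have key : ∀ x : ℝ, d ^ L ≤ x → 256 ≤ x ∧ y ^ 2 ≤ x ∧ 1 < x ∧ 16 ≤ Real.log x ∧
      288 * Real.sqrt x * Real.log x ≤ ε * (δ * (x * c₁ / (4 * d ^ (2 * e)))) ∧
      IntervalIntegrable (fun t ↦ T t / (t * Real.log t ^ 2)) volume 2 x ∧
      ((((Nat.primesLE ⌊x⌋₊).filter Pgood).card : ℕ) : ℝ) =
        T x / Real.log x + ∫ t in (2 : ℝ)..x, T t / (t * Real.log t ^ 2) := by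
    intro x hx
    obtain ⟨hx256, hxL', hx16, hKx⟩ := hthr d hd3 x hx
    have hx2 : (2 : ℝ) ≤ x := by linarith
    have hyy : y ^ 2 ≤ x := by
      rw [hy, ← Real.rpow_natCast, ← Real.rpow_mul hd0.le]
      have : L₁ * ((2 : ℕ) : ℝ) = 2 * L₁ := by push_cast; ring
      rw [this]; exact hxL'
    refine ⟨hx256, hyy, by linarith, hx16, ?_, intervalIntegrable_sum_filter_primesLE_log_div Pgood hx2,
      card_filter_primesLE_eq_div_log_add_integral Pgood hx2⟩
    -- `288 √x log x ≤ ε δ x c₁/(4 d^{2e})` from `K d^{2e} log x ≤ 4 √x`, `K = 1152 n/(ε c₁)`, `δ ≥ 1/n`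
    have hx0 : 0 < x := by linarith
    have hsx : Real.sqrt x * Real.sqrt x = x := Real.mul_self_sqrt hx0.le
    have hD0 : 0 < d ^ (2 * e) := Real.rpow_pos_of_pos hd0 _
    have hK' : 4608 * n * d ^ (2 * e) * Real.log x ≤ 4 * Real.sqrt x * (ε * c₁) := by
      have := hKx
      rw [hK] at this
      have h2 : 4608 * (n : ℝ) / (ε * c₁) * d ^ (2 * e) * Real.log x =
          (4608 * n * d ^ (2 * e) * Real.log x) / (ε * c₁) := by ring
      rw [h2, div_le_iff₀ (by positivity)] at this
      exact this
    have hδn' : 1 ≤ δ * n := by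
      have := mul_le_mul_of_nonneg_right hδn hn0.le
      rwa [one_div, inv_mul_cancel₀ hn0.ne'] at this
    rw [show ε * (δ * (x * c₁ / (4 * d ^ (2 * e)))) = (ε * c₁ * δ * x) / (4 * d ^ (2 * e)) by ring,
      le_div_iff₀ (by positivity)]
    have hlogx0 : 0 ≤ Real.log x := by linarith
    -- `R₀ := 1152 D √x log x`: `n R₀ ≤ ε c₁ x` and `1 ≤ δ n` give `R₀ ≤ ε c₁ δ x`
    set R₀ : ℝ := 1152 * d ^ (2 * e) * Real.sqrt x * Real.log x with hR₀
    have hR₀0 : 0 ≤ R₀ := by positivity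
    have hA : (n : ℝ) * R₀ ≤ ε * c₁ * x := by
      have h1 := mul_le_mul_of_nonneg_right hK' (Real.sqrt_nonneg x)
      have e1 : 4608 * (n : ℝ) * d ^ (2 * e) * Real.log x * Real.sqrt x = 4 * (n * R₀) := by rw [hR₀]; ring
      have e2 : 4 * Real.sqrt x * (ε * c₁) * Real.sqrt x = 4 * (ε * c₁ * x) := by
        linear_combination (4 * (ε * c₁)) * hsx
      rw [e1, e2] at h1
      linarith
    have hB : R₀ ≤ δ * n * R₀ := le_mul_of_one_le_left hR₀0 hδn'
    have hC : δ * n * R₀ ≤ δ * (ε * c₁ * x) := by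
      rw [mul_assoc]; exact mul_le_mul_of_nonneg_left hA hδ0.le
    have e3 : 288 * Real.sqrt x * Real.log x * (4 * d ^ (2 * e)) = R₀ := by rw [hR₀]; ring
    rw [e3]
    linarith
  refine ⟨?_, ?_⟩
  · -- (A): `θ₁ = 0`, `β = 1`
    intro hexc x hx
    obtain ⟨hx256, hyy, hx1, hx16, hjunk, hTint, hP⟩ := key x hx
    have hTE : ∀ t, y ≤ t → |T t - δ * (t - 0 * t ^ (1 : ℝ) / 1)| ≤ ε₀ * (δ * (t - 0 * t ^ (1 : ℝ) / 1)) := by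
      intro t ht
      have := hA hexc t (hyL₀.trans ht)
      simp only [zero_mul, zero_div, sub_zero]
      exact this
    have hmain := division_pi_transfer (θ₁ := 0) (β := 1) (F := x - 0 * x ^ (1 : ℝ) / 1) (W := x * c₁ / (4 * d ^ (2 * e)))
      hδ0 hδ1 (by norm_num) (by norm_num) le_rfl hε₀0.le (by rw [hε₀]; linarith) hy2 hT0 hTB hTE hx256 hyy
      hTint hP rfl ?_ hjunk
    · simpa only [zero_mul, sub_zero] using hmain
    · -- `W ≤ x`
      simp only [zero_mul, zero_div, sub_zero]
      have hx0 : 0 < x := by linarith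
      have hD1 : 1 ≤ d ^ (2 * e) := Real.one_le_rpow hd1 (by positivity)
      rw [div_le_iff₀ (by positivity)]
      nlinarith [mul_le_mul_of_nonneg_left hD1 hx0.le]
  · -- (B)
    intro β₁ hζ₁ hβ₁c hβ₁1
    obtain ⟨hB1, hB2⟩ := hB β₁ hζ₁ hβ₁c hβ₁1
    have hβ34 : 3 / 4 ≤ β₁ := three_quarters_le_of_window hc hc4 hd3 hβ₁c
    have hβhalf : 1 / 2 < β₁ := by linarith
    refine ⟨?_, ?_⟩
    · -- (B1): `θ₁ = 1`
      intro hζσ x hx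
      obtain ⟨hx256, hyy, hx1, hx16, hjunk, hTint, hP⟩ := key x hx
      have hTE : ∀ t, y ≤ t → |T t - δ * (t - 1 * t ^ β₁ / β₁)| ≤ ε₀ * (δ * (t - 1 * t ^ β₁ / β₁)) := by
        intro t ht
        have := (hB1 hζσ t (hyL₀.trans ht)).2
        simp only [one_mul]
        exact this
      have hW : x * c₁ / (4 * d ^ (2 * e)) ≤ x - 1 * x ^ β₁ / β₁ := by
        rw [one_mul]; exact hMT N hN β₁ hζ₁ hβ34 hβ₁1 x hx1 hx16
      have hmain := division_pi_transfer (θ₁ := 1) (β := β₁) hδ0 hδ1 (by norm_num) hβhalf hβ₁1.le hε₀0.le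
        (by rw [hε₀]; linarith) hy2 hT0 hTB hTE hx256 hyy hTint hP rfl hW hjunk
      simpa only [one_mul] using hmain
    · -- (B2): `θ₁ = −1`
      intro hζσ x hx
      obtain ⟨hx256, hyy, hx1, hx16, hjunk, hTint, hP⟩ := key x hx
      have hx0 : 0 < x := by linarith
      have hβ0 : 0 < β₁ := by linarith
      have hTE : ∀ t, y ≤ t → |T t - δ * (t - (-1) * t ^ β₁ / β₁)| ≤ ε₀ * (δ * (t - (-1) * t ^ β₁ / β₁)) := by
        intro t ht
        have := hB2 hζσ t (hyL₀.trans ht)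
        simp only [neg_one_mul, neg_div, sub_neg_eq_add]
        exact this
      have hW : x * c₁ / (4 * d ^ (2 * e)) ≤ x - (-1) * x ^ β₁ / β₁ := by
        rw [neg_one_mul, neg_div, sub_neg_eq_add]
        have hy0 : 0 ≤ x ^ β₁ / β₁ := div_nonneg (Real.rpow_nonneg hx0.le _) hβ0.le
        have hD1 : 1 ≤ d ^ (2 * e) := Real.one_le_rpow hd1 (by positivity)
        rw [div_le_iff₀ (by positivity)]
        nlinarith [mul_le_mul_of_nonneg_left hD1 hx0.le]
      have hmain := division_pi_transfer (θ₁ := -1) (β := β₁) hδ0 hδ1 (by norm_num) hβhalf hβ₁1.le hε₀0.le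
        (by rw [hε₀]; linarith) hy2 hT0 hTB hTE hx256 hyy hTint hP rfl hW hjunk
      simpa only [neg_one_mul, sub_neg_eq_add] using hmain

end Summit.QuantumAdvantage.QuantumAdvantage.Theorems.DegreeOnePrimesEscape

end
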